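import Summits.QuantumFields.QCD.Theses.HeatSlicedQuarks
import Literature.MathematicalPhysics.QuantumLattice.LatticeToriProofs
import Mathlib.Analysis.PSeries

/-!
# Stub `stub_imageSum` of line `Sketch`
(crux `Summit.QuantumFields.QCD.Theses.HeatSlicedQuarks.InterleavedHeatSliceFlow`, item stmt-QuantumFields-8891)

**Image sum** (reshape r4, statement `ImageSum`).  Let `π : T_{NL} → T_L` be the coordinatewise
reduction `(ℤ/NLℤ)⁴ → (ℤ/Lℤ)⁴` (`ZMod.castHom`) of the `N⁴`-sheeted covering of the discrete
four-torus.  For every site `x̃ ∈ T_{NL}` and every `θ > 0`, the lattice sum over the non-trivial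
deck images of `x̃`,

  `Σ_{z̃ : π z̃ = π x̃, z̃ ≠ x̃} (1 + d(x̃, z̃)²/θ)⁻³ ≤ 432 · (θ/L²)³`,

`d` the periodic sup-distance `torusDist` of `T_{NL}`.

## Proof

Pure lattice arithmetic.
1. *Fibre coordinates.*  If `π z̃ = π x̃` then every coordinate of `w = z̃ - x̃` lies in the kernel of
   `ZMod (N L) → ZMod L`, i.e. `(w μ).val = L · q_μ` with `q_μ < N` (`deck_coord`); the site
   `k(z̃) = (q_μ mod N)_μ ∈ T_N` determines `z̃` (`deck_inj`).
2. *Distances scale.*  `d(x̃, z̃) = ‖w‖ = max_μ min (L q_μ, N L - L q_μ) = L · ‖k(z̃)‖`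
   (`torusNorm_eq_mul`, `torusDist_deck`), and `‖k(z̃)‖ ≥ 1` for `z̃ ≠ x̃` (`one_le_torusNorm_deck`).
3. *Termwise.*  `(1 + L²ρ²/θ)⁻³ ≤ (θ/(L²ρ²))³` for `ρ = ‖k(z̃)‖ ≥ 1` (`term_le`); the sum over the
   images is therefore at most `Σ_{k ∈ T_N} (θ/(L² ‖k‖²))³` (injectivity of `z̃ ↦ k(z̃)`,
   `sum_le_sum_of_injOn_nonneg`; the term `k = 0` contributes the junk value `(θ/0)³ = 0`).
4. *Radial summation* on `T_N` (`sum_radial_le` with the sphere count `card_filter_torusDist_eq_le`,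
   at most `8 (2ρ+1)³ ≤ 216 ρ³` sites with `‖k‖ = ρ ≥ 1`) and `Σ_{ρ ≥ 1} ρ³ · ρ⁻⁶ ≤ Σ ρ⁻² ≤ 2`
   (`sum_Ioo_inv_sq_le`) give the constant `216 · 2 = 432` (`radial_bound`, `small_torus_sum`).

Leans on: `torusNorm`, `torusDist`, `torusDist_comm'`, `torusDist_lt`, `card_filter_torusDist_eq_le`,
`sum_radial_le` (tree, `LatticeTori` / `LatticeToriProofs`); `ZMod.castHom`, `ZMod.cast_eq_val`,
`ZMod.natCast_eq_zero_iff`, `ZMod.val_cast_of_lt`, `sum_Ioo_inv_sq_le` (Mathlib).  No named facts.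
-/

namespace Summit.QuantumFields.QCD.Cruxes.InterleavedHeatSliceFlow.Sketch

open Literature.MathematicalPhysics.QuantumLattice Literature.MathematicalPhysics.QuantumFieldTheory
  Literature.Probability.LatticeModels
open Summit.QuantumFields.QCD.Theses.HeatSlicedQuarks
open scoped Matrix

/-! ### The torus norm -/

/-- On a cubic torus with nonzero side, only the origin has periodic sup-norm `0`. -/
private theorem eq_zero_of_torusNorm_eq_zero {d n : ℕ} [NeZero n] {k : TorusSite d n}
    (h : torusNorm k = 0) : k = 0 := by
  funext μ
  have hμ : min (k μ).val (n - (k μ).val) ≤ 0 :=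
    h ▸ Finset.le_sup (f := fun i => min (k i).val (n - (k i).val)) (Finset.mem_univ μ)
  have hlt := ZMod.val_lt (k μ)
  have h0 : (k μ).val = 0 := by omega
  exact (ZMod.val_eq_zero _).mp h0

/-- If every coordinate representative of `w ∈ T_{NL}` is `L` times that of `k ∈ T_N`, then
`‖w‖ = L · ‖k‖` for the periodic sup-norms. -/
private theorem torusNorm_eq_mul {d N L : ℕ} [NeZero N] (w : TorusSite d (N * L)) (k : TorusSite d N)
    (h : ∀ μ, (w μ).val = L * (k μ).val) : torusNorm w = L * torusNorm k := by
  have hmono : Monotone fun t : ℕ => L * t := fun a b hab => Nat.mul_le_mul_left L hab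
  simp only [torusNorm]
  rw [Finset.apply_sup_eq_sup_comp_of_linearOrder (fun t : ℕ => L * t) hmono (mul_zero L)]
  congr 1
  funext μ
  simp only [Function.comp_apply, h μ]
  rw [show N * L - L * (k μ).val = L * (N - (k μ).val) by rw [mul_tsub, mul_comm N L]]
  exact (hmono.map_min).symm

/-! ### The fibres of the covering map -/

/-- The kernel of the reduction `ZMod (N L) → ZMod L` consists of the classes whose representative
is a multiple of `L`. -/
private theorem dvd_val_of_castHom_eq_zero {N L : ℕ} [NeZero (N * L)] {a : ZMod (N * L)}
    (h : ZMod.castHom (dvd_mul_left L N) (ZMod L) a = 0) : L ∣ a.val := by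
  rw [ZMod.castHom_apply, ZMod.cast_eq_val] at h
  exact (ZMod.natCast_eq_zero_iff _ _).mp h

/-- `N ≠ 0` when `N L ≠ 0`. -/
private theorem neZero_left {N L : ℕ} [NeZero (N * L)] : NeZero N :=
  ⟨by rintro rfl; exact NeZero.ne (0 * L) (zero_mul L)⟩

/-- Fibre coordinates: if `π z̃ = π x̃` then `((z̃ - x̃) μ).val = L · q_μ` with `q_μ < N` the
representative of the `μ`-th coordinate of the deck label `k(z̃) ∈ T_N`. -/
private theorem deck_coord {N L : ℕ} [NeZero (N * L)] {x z : TorusSite 4 (N * L)}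
    (h : ∀ μ, ZMod.castHom (dvd_mul_left L N) (ZMod L) (z μ) =
      ZMod.castHom (dvd_mul_left L N) (ZMod L) (x μ)) (μ : Fin 4) :
    ((z - x) μ).val = L * ((((z - x) μ).val / L : ℕ) : ZMod N).val := by
  have hdvd : L ∣ ((z - x) μ).val :=
    dvd_val_of_castHom_eq_zero (by rw [Pi.sub_apply, map_sub, sub_eq_zero]; exact h μ)
  have hlt : ((z - x) μ).val / L < N :=
    Nat.div_lt_of_lt_mul ((ZMod.val_lt _).trans_eq (Nat.mul_comm N L))
  rw [ZMod.val_cast_of_lt hlt, Nat.mul_div_cancel' hdvd]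

/-- The deck label `k(z̃) ∈ T_N` determines the point of the fibre. -/
private theorem deck_inj {N L : ℕ} [NeZero (N * L)] {x z₁ z₂ : TorusSite 4 (N * L)}
    (h₁ : ∀ μ, ZMod.castHom (dvd_mul_left L N) (ZMod L) (z₁ μ) =
      ZMod.castHom (dvd_mul_left L N) (ZMod L) (x μ))
    (h₂ : ∀ μ, ZMod.castHom (dvd_mul_left L N) (ZMod L) (z₂ μ) =
      ZMod.castHom (dvd_mul_left L N) (ZMod L) (x μ))
    (heq : ∀ μ, ((((z₁ - x) μ).val / L : ℕ) : ZMod N) = ((((z₂ - x) μ).val / L : ℕ) : ZMod N)) :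
    z₁ = z₂ := by
  funext μ
  have e : ((z₁ - x) μ).val = ((z₂ - x) μ).val := by
    rw [deck_coord h₁ μ, deck_coord h₂ μ, heq μ]
  have := ZMod.val_injective _ e
  rwa [Pi.sub_apply, Pi.sub_apply, sub_left_inj] at this

/-- Distances to deck images scale: `d(x̃, z̃) = L · ‖k(z̃)‖`. -/
private theorem torusDist_deck {N L : ℕ} [NeZero (N * L)] {x z : TorusSite 4 (N * L)}
    (h : ∀ μ, ZMod.castHom (dvd_mul_left L N) (ZMod L) (z μ) =
      ZMod.castHom (dvd_mul_left L N) (ZMod L) (x μ)) :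
    torusDist x z =
      L * torusNorm (Ls := fun _ : Fin 4 => N) (fun μ => ((((z - x) μ).val / L : ℕ) : ZMod N)) := by
  haveI : NeZero N := neZero_left (L := L)
  rw [torusDist_comm']
  unfold torusDist
  exact torusNorm_eq_mul (z - x) _ (fun μ => deck_coord h μ)

/-- A non-trivial deck image has deck label of norm `≥ 1`. -/
private theorem one_le_torusNorm_deck {N L : ℕ} [NeZero (N * L)] {x z : TorusSite 4 (N * L)}
    (h : ∀ μ, ZMod.castHom (dvd_mul_left L N) (ZMod L) (z μ) =
      ZMod.castHom (dvd_mul_left L N) (ZMod L) (x μ)) (hne : z ≠ x) :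
    1 ≤ torusNorm (Ls := fun _ : Fin 4 => N) (fun μ => ((((z - x) μ).val / L : ℕ) : ZMod N)) := by
  rcases Nat.eq_zero_or_pos
      (torusNorm (Ls := fun _ : Fin 4 => N) (fun μ => ((((z - x) μ).val / L : ℕ) : ZMod N)))
    with h0 | h0
  · exfalso
    apply hne
    have hd : torusDist x z = 0 := by rw [torusDist_deck h, h0, mul_zero]
    unfold torusDist at hd
    exact (sub_eq_zero.mp (eq_zero_of_torusNorm_eq_zero hd)).symm
  · exact h0

/-! ### Real-number bookkeeping -/

/-- `(1 + a/θ)⁻³ ≤ (θ/a)³` for `a, θ > 0`. -/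
private theorem inv_cube_le {a θ : ℝ} (ha : 0 < a) (hθ : 0 < θ) :
    ((1 + a / θ) ^ 3)⁻¹ ≤ (θ / a) ^ 3 := by
  have hpos : 0 < a / θ := div_pos ha hθ
  calc ((1 + a / θ) ^ 3)⁻¹ ≤ ((a / θ) ^ 3)⁻¹ := by
        apply inv_anti₀ (pow_pos hpos 3)
        gcongr
        linarith
    _ = (θ / a) ^ 3 := by rw [← inv_pow, inv_div]

/-- Termwise bound: for a non-trivial deck image `z̃` of `x̃` with deck label of norm `ρ`,
`(1 + d(x̃,z̃)²/θ)⁻³ ≤ (θ/(L²ρ²))³`. -/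
private theorem term_le {N L : ℕ} [NeZero L] [NeZero (N * L)] {x z : TorusSite 4 (N * L)}
    (h : ∀ μ, ZMod.castHom (dvd_mul_left L N) (ZMod L) (z μ) =
      ZMod.castHom (dvd_mul_left L N) (ZMod L) (x μ)) (hne : z ≠ x) {θ : ℝ} (hθ : 0 < θ) :
    ((1 + (torusDist x z : ℝ) ^ 2 / θ) ^ 3)⁻¹ ≤
      (θ / ((L : ℝ) ^ 2 *
        ((torusNorm (Ls := fun _ : Fin 4 => N)
          (fun μ => ((((z - x) μ).val / L : ℕ) : ZMod N)) : ℕ) : ℝ) ^ 2)) ^ 3 := by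
  have hρ := one_le_torusNorm_deck h hne
  rw [torusDist_deck h]
  generalize torusNorm (Ls := fun _ : Fin 4 => N)
    (fun μ => ((((z - x) μ).val / L : ℕ) : ZMod N)) = ρ at hρ ⊢
  have hL : (0 : ℝ) < L := Nat.cast_pos.mpr (Nat.pos_of_ne_zero (NeZero.ne L))
  have hρ' : (0 : ℝ) < ρ := by exact_mod_cast hρ
  push_cast
  rw [mul_pow]
  exact inv_cube_le (mul_pos (pow_pos hL 2) (pow_pos hρ' 2)) hθ

/-- The radial series: `Σ_{ρ < N} 8 (2ρ+1)³ · (θ/(L²ρ²))³ ≤ 432 (θ/L²)³` (the `ρ = 0` term is the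
junk value `0`; for `ρ ≥ 1`, `8 (2ρ+1)³ ≤ 216 ρ³` and `Σ ρ⁻³ ≤ Σ ρ⁻² ≤ 2`). -/
private theorem radial_bound (N : ℕ) {L θ : ℝ} (hL : 0 < L) (hθ : 0 < θ) :
    ∑ r ∈ Finset.range N, ((4 * (2 * (2 * r + 1) ^ 3) : ℕ) : ℝ) * (θ / (L ^ 2 * (r : ℝ) ^ 2)) ^ 3 ≤
      432 * (θ / L ^ 2) ^ 3 := by
  have hterm : ∀ r ∈ Finset.range N,
      ((4 * (2 * (2 * r + 1) ^ 3) : ℕ) : ℝ) * (θ / (L ^ 2 * (r : ℝ) ^ 2)) ^ 3 ≤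
        216 * (θ / L ^ 2) ^ 3 * ((r : ℝ) ^ 2)⁻¹ := by
    intro r _
    rcases Nat.eq_zero_or_pos r with rfl | hr
    · simp
    · have hr' : (1 : ℝ) ≤ r := by exact_mod_cast hr
      have hr0 : (0 : ℝ) < r := by linarith
      push_cast
      calc (4 * (2 * (2 * (r : ℝ) + 1) ^ 3)) * (θ / (L ^ 2 * (r : ℝ) ^ 2)) ^ 3
          ≤ (4 * (2 * (3 * (r : ℝ)) ^ 3)) * (θ / (L ^ 2 * (r : ℝ) ^ 2)) ^ 3 := by
            gcongr
            linarith
        _ = 216 * (θ / L ^ 2) ^ 3 * ((r : ℝ) ^ 3)⁻¹ := by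
            field_simp
            ring
        _ ≤ 216 * (θ / L ^ 2) ^ 3 * ((r : ℝ) ^ 2)⁻¹ :=
            mul_le_mul_of_nonneg_left
              (inv_anti₀ (pow_pos hr0 2) (pow_le_pow_right₀ hr' (by norm_num : (2 : ℕ) ≤ 3)))
              (by positivity)
  have hsum : ∑ r ∈ Finset.range N, ((r : ℝ) ^ 2)⁻¹ ≤ 2 := by
    rcases Nat.eq_zero_or_pos N with rfl | hN
    · simp
    · rw [Finset.range_eq_Ico, ← Finset.Ioo_insert_left hN, Finset.sum_insert (by simp)]
      have h := sum_Ioo_inv_sq_le (α := ℝ) 0 N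
      have h0 : (((0 : ℕ) : ℝ) ^ 2)⁻¹ = 0 := by simp
      rw [h0, zero_add]
      calc _ ≤ (2 : ℝ) / (0 + 1) := by exact_mod_cast h
        _ = 2 := by norm_num
  calc _ ≤ ∑ r ∈ Finset.range N, 216 * (θ / L ^ 2) ^ 3 * ((r : ℝ) ^ 2)⁻¹ := Finset.sum_le_sum hterm
    _ = 216 * (θ / L ^ 2) ^ 3 * ∑ r ∈ Finset.range N, ((r : ℝ) ^ 2)⁻¹ := by rw [Finset.mul_sum]
    _ ≤ 216 * (θ / L ^ 2) ^ 3 * 2 := by gcongr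
    _ = 432 * (θ / L ^ 2) ^ 3 := by ring

/-- The comparison sum on the small torus: `Σ_{k ∈ T_N} (θ/(L² ‖k‖²))³ ≤ 432 (θ/L²)³`
(radial summation `sum_radial_le` against the sphere count `card_filter_torusDist_eq_le`, then
`radial_bound`). -/
private theorem small_torus_sum (N : ℕ) [NeZero N] {L θ : ℝ} (hL : 0 < L) (hθ : 0 < θ) :
    ∑ k : TorusSite 4 N, (θ / (L ^ 2 * ((torusNorm k : ℕ) : ℝ) ^ 2)) ^ 3 ≤ 432 * (θ / L ^ 2) ^ 3 := by
  have hF0 : ∀ r : ℕ, 0 ≤ (θ / (L ^ 2 * (r : ℝ) ^ 2)) ^ 3 := fun r => by positivity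
  have h := sum_radial_le (fun r : ℕ => (θ / (L ^ 2 * (r : ℝ) ^ 2)) ^ 3) hF0 (0 : TorusSite 4 N)
    (fun r => card_filter_torusDist_eq_le (by norm_num) 0 r) (fun u => torusDist_lt u 0)
  simp only [torusDist, sub_zero] at h
  exact h.trans (radial_bound N hL hθ)

/-- A weighted injection bound: if `φ` is injective on `S`, maps `S` into `T`, `g ≤ G ∘ φ` on `S` and
`G ≥ 0` on `T`, then `Σ_S g ≤ Σ_T G`. -/
private theorem sum_le_sum_of_injOn_nonneg {α β : Type*} [DecidableEq β] {S : Finset α}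
    {T : Finset β} {g : α → ℝ} {G : β → ℝ} (φ : α → β) (hinj : Set.InjOn φ S)
    (hmaps : ∀ z ∈ S, φ z ∈ T) (hle : ∀ z ∈ S, g z ≤ G (φ z)) (hG : ∀ k ∈ T, 0 ≤ G k) :
    ∑ z ∈ S, g z ≤ ∑ k ∈ T, G k :=
  calc ∑ z ∈ S, g z ≤ ∑ z ∈ S, G (φ z) := Finset.sum_le_sum hle
    _ = ∑ k ∈ S.image φ, G k := (Finset.sum_image hinj).symm
    _ ≤ ∑ k ∈ T, G k :=
        Finset.sum_le_sum_of_subset_of_nonneg (Finset.image_subset_iff.mpr hmaps)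
          fun k hk _ => hG k hk

/-! ### The stub -/

/-- **Image sum** (registered stub `stub_imageSum` of line `Sketch`, reshape r4; statement
`ImageSum`): on the `N⁴`-sheeted cover `T_{NL} → T_L` (coordinatewise `ZMod.castHom`), for every
site `x̃` and every `θ > 0`, `Σ_{z̃ ∈ π⁻¹(π x̃), z̃ ≠ x̃} (1 + d(x̃,z̃)²/θ)⁻³ ≤ 432 (θ/L²)³`.
Proof: the deck images are `x̃ + L k`, `k ∈ T_N ∖ {0}`, at distance `L ‖k‖` (`torusDist_deck`,
`deck_inj`); termwise `(1 + L²ρ²/θ)⁻³ ≤ (θ/(L²ρ²))³` (`term_le`); radial summation on `T_N` with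
the sphere count `≤ 8(2ρ+1)³ ≤ 216ρ³` and `Σ ρ⁻³ ≤ 2` (`small_torus_sum`). -/
theorem stub_imageSum :
    ∃ C : ℝ, ∀ (N L : ℕ) [NeZero L] [NeZero (N * L)] (x : TorusSite 4 (N * L)) (θ : ℝ), 0 < θ →
      ∑ z ∈ Finset.univ.filter (fun z : TorusSite 4 (N * L) =>
          (fun μ => ZMod.castHom (dvd_mul_left L N) (ZMod L) (z μ)) =
            (fun μ => ZMod.castHom (dvd_mul_left L N) (ZMod L) (x μ)) ∧ z ≠ x),
        ((1 + (torusDist x z : ℝ) ^ 2 / θ) ^ 3)⁻¹ ≤ C * (θ / (L : ℝ) ^ 2) ^ 3 := by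
  refine ⟨432, fun N L _ _ x θ hθ => ?_⟩
  haveI : NeZero N := neZero_left (L := L)
  have hL : (0 : ℝ) < L := Nat.cast_pos.mpr (Nat.pos_of_ne_zero (NeZero.ne L))
  refine le_trans ?_ (small_torus_sum N hL hθ)
  refine sum_le_sum_of_injOn_nonneg
    (fun (z : TorusSite 4 (N * L)) (μ : Fin 4) => ((((z - x) μ).val / L : ℕ) : ZMod N))
    ?_ (fun z _ => Finset.mem_univ _) ?_ (fun k _ => by positivity)
  · intro z₁ hz₁ z₂ hz₂ heq
    simp only [Finset.coe_filter, Finset.mem_univ, true_and, Set.mem_setOf_eq] at hz₁ hz₂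
    exact deck_inj (fun μ => congrFun hz₁.1 μ) (fun μ => congrFun hz₂.1 μ) (fun μ => congrFun heq μ)
  · intro z hz
    rw [Finset.mem_filter] at hz
    exact term_le (fun μ => congrFun hz.2.1 μ) hz.2.2 hθ

end Summit.QuantumFields.QCD.Cruxes.InterleavedHeatSliceFlow.Sketch
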